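import Summits.AtomisticToContinuum.Crystallization.Theorems.ExcessDecayLiouvilleHcpLiouvilleBlowdownGalerkinLimit
import Summits.AtomisticToContinuum.Crystallization.Theorems.ExcessDecayLiouvilleHcpLiouvilleBlowdownPathSup
import Summits.AtomisticToContinuum.Crystallization.Theorems.ExcessDecayLiouvillePathSums

/-!
# `ExcessDecayLiouville.HcpLiouville` (stmt-AtomisticToContinuum-9332), line `Sketch` v4: the Galerkin limit, II

Helper file for sub-goal `blowdown_greenSolve` (H2 of stub `stub_green`) of crux stmt-AtomisticToContinuum-9332
(`Summit.AtomisticToContinuum.Crystallization.Theses.ExcessDecayLiouville.HcpLiouville`), line `Sketch`, skeleton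
v4.  For a pointwise limit `G` of a Galerkin family (admissible right-hand side `f`, capacity hypothesis `hcap`):
(i) the ROWS pass to the limit, `HasSum_q K(p − q)(G p − G q) = f p` (Tannery's theorem along the net of finite
sets of sites, domination `‖K(p − q)‖ · ‖U V p − U V q‖ ≲ dist⁻⁸ · (1 + dist) · N/κ` from `norm_forceConst_le` and
the sup path bound `blowdown_pathSup`); (iv) the TRANSLATION DIFFERENCES along the generators `u₁, u₂, w₃` are
square-summable with `Σ'_p ‖G(p + Ae) − G p‖² ≤ 4 (N/κ)²` (the finite-level bounds of `ExcessDecayLiouvillePathSums`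
/ `…Cutoff` and Fatou on finite partial sums).  All `[folklore]`; a `--supports` helper, nothing here closes an item.
-/

noncomputable section

namespace Summit.AtomisticToContinuum.Crystallization.Theorems.ExcessDecayLiouville

open scoped BigOperators Topology Classical InnerProductSpace RealInnerProductSpace
open Filter
open Literature.MathematicalPhysics.StatisticalMechanics
open Summit.AtomisticToContinuum.Crystallization.Theses.ExcessDecayLiouville
open Summit.AtomisticToContinuum.Crystallization.Theorems.PhononStabilityNegative

section

variable {t : Fin 2 → EuclideanSpace ℝ (Fin 3)} {A : EuclideanSpace ℝ (Fin 3) →L[ℝ] EuclideanSpace ℝ (Fin 3)}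
  {κ : ℝ} {f : EuclideanSpace ℝ (Fin 3) → EuclideanSpace ℝ (Fin 3)} {N : ℝ}
  {U : Finset (Sites₀ t A) → EuclideanSpace ℝ (Fin 3) → EuclideanSpace ℝ (Fin 3)} {C : ℝ}

/-! ## Clause (i): the rows of the limit -/

/-- **Domination of the row terms at the finite level**: with the sup path constant `C₀` (`blowdown_pathSup`),
`‖K(p − q)(u p − u q)‖ ≤ 38 · max C₀ 0 · (N/κ) · (dist⁻⁸ + dist⁻⁷)` off the diagonal. [folklore] -/
theorem norm_row_term_le (hA : Adm₀ A) (hI : Inner₀ t A) (hκ : 0 < κ) (hPS : Blowdown.PSIneq κ t A) (hN : 0 ≤ N)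
    (hf : ∀ w : EuclideanSpace ℝ (Fin 3) → EuclideanSpace ℝ (Fin 3), (Function.support w).Finite →
      Function.support w ⊆ Sites₀ t A → |∑' p : Sites₀ t A, ⟪f p, w p⟫| ≤ N * Real.sqrt (nnForm t A w))
    {V : Finset (Sites₀ t A)} {u : EuclideanSpace ℝ (Fin 3) → EuclideanSpace ℝ (Fin 3)}
    (hu : Function.support u ⊆ Subtype.val '' (V : Set (Sites₀ t A)))
    (hru : ∀ p : Sites₀ t A, p ∈ V →
      ∑' q : Sites₀ t A, forceConst ((p : EuclideanSpace ℝ (Fin 3)) - q) (u p - u q) = f p)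
    {C₀ : ℝ} (hC₀ : ∀ w : EuclideanSpace ℝ (Fin 3) → EuclideanSpace ℝ (Fin 3), (Function.support w).Finite →
      Function.support w ⊆ Sites₀ t A → ∀ p ∈ Sites₀ t A, ∀ q ∈ Sites₀ t A,
        ‖w p - w q‖ ≤ C₀ * (1 + dist p q) * Real.sqrt (nnForm t A w))
    (p q : Sites₀ t A) :
    ‖forceConst ((p : EuclideanSpace ℝ (Fin 3)) - q) (u p - u q)‖ ≤ 38 * max C₀ 0 * (N / κ) *
      ((if (p : EuclideanSpace ℝ (Fin 3)) ≠ q then (dist (p : EuclideanSpace ℝ (Fin 3)) q)⁻¹ ^ (5 + 3) else 0) +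
        (if (p : EuclideanSpace ℝ (Fin 3)) ≠ q then (dist (p : EuclideanSpace ℝ (Fin 3)) q)⁻¹ ^ (4 + 3) else 0)) := by
  by_cases hpq : (p : EuclideanSpace ℝ (Fin 3)) = q
  · have hpq' : p = q := Subtype.ext hpq
    subst hpq'
    simp
  · rw [if_pos hpq, if_pos hpq]
    have hd : (23 / 25 : ℝ) ≤ dist (p : EuclideanSpace ℝ (Fin 3)) q := dist_sites_ge hA hI p.2 q.2 hpq
    have he : 9 / 10 ≤ ‖(p : EuclideanSpace ℝ (Fin 3)) - q‖ := by rw [← dist_eq_norm]; linarith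
    have hr0 : 0 < ‖(p : EuclideanSpace ℝ (Fin 3)) - q‖ := by linarith
    have hK := norm_forceConst_le he
    have hsq := (energy_bounds hA hI hκ hPS hN hf hu hru).1
    have hpath := hC₀ u (finite_support_of_subset_image hu) (support_subset_sites_of_subset_image hu) p p.2 q q.2
    have hd0 : 0 ≤ 1 + dist (p : EuclideanSpace ℝ (Fin 3)) q := by positivity
    have hpath' : ‖u p - u q‖ ≤ max C₀ 0 * (1 + dist (p : EuclideanSpace ℝ (Fin 3)) q) * (N / κ) := by
      refine hpath.trans ?_
      have h1 : C₀ * (1 + dist (p : EuclideanSpace ℝ (Fin 3)) q) * Real.sqrt (nnForm t A u) ≤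
          max C₀ 0 * (1 + dist (p : EuclideanSpace ℝ (Fin 3)) q) * Real.sqrt (nnForm t A u) :=
        mul_le_mul_of_nonneg_right (mul_le_mul_of_nonneg_right (le_max_left _ _) hd0) (Real.sqrt_nonneg _)
      refine h1.trans ?_
      exact mul_le_mul_of_nonneg_left hsq (mul_nonneg (le_max_right _ _) hd0)
    have hr : (dist (p : EuclideanSpace ℝ (Fin 3)) q)⁻¹ ^ (5 + 3) + (dist (p : EuclideanSpace ℝ (Fin 3)) q)⁻¹ ^ (4 + 3) =
        (‖(p : EuclideanSpace ℝ (Fin 3)) - q‖⁻¹) ^ 8 * (1 + dist (p : EuclideanSpace ℝ (Fin 3)) q) := by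
      rw [dist_eq_norm]
      have h8 : (‖(p : EuclideanSpace ℝ (Fin 3)) - q‖⁻¹) ^ 8 * ‖(p : EuclideanSpace ℝ (Fin 3)) - q‖ =
          (‖(p : EuclideanSpace ℝ (Fin 3)) - q‖⁻¹) ^ 7 := by
        rw [pow_succ, mul_assoc, inv_mul_cancel₀ hr0.ne', mul_one]
      rw [mul_add, mul_one, h8]
    calc ‖forceConst ((p : EuclideanSpace ℝ (Fin 3)) - q) (u p - u q)‖
        ≤ ‖forceConst ((p : EuclideanSpace ℝ (Fin 3)) - q)‖ * ‖u p - u q‖ := ContinuousLinearMap.le_opNorm _ _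
      _ ≤ (38 * (‖(p : EuclideanSpace ℝ (Fin 3)) - q‖⁻¹) ^ 8) *
            (max C₀ 0 * (1 + dist (p : EuclideanSpace ℝ (Fin 3)) q) * (N / κ)) :=
          mul_le_mul hK hpath' (norm_nonneg _) (by positivity)
      _ = 38 * max C₀ 0 * (N / κ) * ((‖(p : EuclideanSpace ℝ (Fin 3)) - q‖⁻¹) ^ 8 *
            (1 + dist (p : EuclideanSpace ℝ (Fin 3)) q)) := by ring
      _ = _ := by rw [hr]

/-- **The rows of the limit** (clause (i)): `HasSum_q K(p − q)(G p − G q) = f p` at every site `p` (Tannery along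
the net of finite sets of sites). [folklore] -/
theorem hasSum_row_lim (hA : Adm₀ A) (hI : Inner₀ t A) (hκ : 0 < κ) (hPS : Blowdown.PSIneq κ t A) (hN : 0 ≤ N)
    (hf : ∀ w : EuclideanSpace ℝ (Fin 3) → EuclideanSpace ℝ (Fin 3), (Function.support w).Finite →
      Function.support w ⊆ Sites₀ t A → |∑' p : Sites₀ t A, ⟪f p, w p⟫| ≤ N * Real.sqrt (nnForm t A w))
    (hU : ∀ V : Finset (Sites₀ t A), Function.support (U V) ⊆ Subtype.val '' (V : Set (Sites₀ t A)) ∧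
      ∀ p : Sites₀ t A, p ∈ V →
        ∑' q : Sites₀ t A, forceConst ((p : EuclideanSpace ℝ (Fin 3)) - q) (U V p - U V q) = f p)
    {G : EuclideanSpace ℝ (Fin 3) → EuclideanSpace ℝ (Fin 3)}
    (hG : ∀ p : Sites₀ t A, Tendsto (fun V : Finset (Sites₀ t A) => U V p) atTop (𝓝 (G p))) (p : Sites₀ t A) :
    HasSum (fun q : Sites₀ t A => forceConst ((p : EuclideanSpace ℝ (Fin 3)) - q) (G p - G q)) (f p) := by
  obtain ⟨C₀, hC₀⟩ := blowdown_pathSup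
  set bound : Sites₀ t A → ℝ := fun q => 38 * max C₀ 0 * (N / κ) *
      ((if (p : EuclideanSpace ℝ (Fin 3)) ≠ q then (dist (p : EuclideanSpace ℝ (Fin 3)) q)⁻¹ ^ (5 + 3) else 0) +
        (if (p : EuclideanSpace ℝ (Fin 3)) ≠ q then (dist (p : EuclideanSpace ℝ (Fin 3)) q)⁻¹ ^ (4 + 3) else 0))
    with hbound
  have hbs : Summable bound :=
    ((flatDiff_summable_inv_pow_sites hA hI p.2 (k := 5) (by norm_num)).1.add
      (flatDiff_summable_inv_pow_sites hA hI p.2 (k := 4) (by norm_num)).1).mul_left _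
  have hdom : ∀ (V : Finset (Sites₀ t A)) (q : Sites₀ t A),
      ‖forceConst ((p : EuclideanSpace ℝ (Fin 3)) - q) (U V p - U V q)‖ ≤ bound q :=
    fun V q => norm_row_term_le hA hI hκ hPS hN hf (hU V).1 (hU V).2 (hC₀ t A hA hI) p q
  have hlim : ∀ q : Sites₀ t A, Tendsto (fun V : Finset (Sites₀ t A) =>
      forceConst ((p : EuclideanSpace ℝ (Fin 3)) - q) (U V p - U V q)) atTop
      (𝓝 (forceConst ((p : EuclideanSpace ℝ (Fin 3)) - q) (G p - G q))) :=
    fun q => ((forceConst _).continuous.tendsto _).comp ((hG p).sub (hG q))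
  have hT := tendsto_tsum_of_dominated_convergence hbs hlim (Eventually.of_forall hdom)
  have hev : ∀ᶠ V : Finset (Sites₀ t A) in atTop,
      f p = ∑' q : Sites₀ t A, forceConst ((p : EuclideanSpace ℝ (Fin 3)) - q) (U V p - U V q) := by
    filter_upwards [eventually_ge_atTop ({p} : Finset (Sites₀ t A))] with V hV
    exact ((hU V).2 p (hV (Finset.mem_singleton_self p))).symm
  have hT' : Tendsto (fun V : Finset (Sites₀ t A) =>
      ∑' q : Sites₀ t A, forceConst ((p : EuclideanSpace ℝ (Fin 3)) - q) (U V p - U V q)) atTop (𝓝 (f p)) :=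
    tendsto_const_nhds.congr' hev
  have heq : ∑' q : Sites₀ t A, forceConst ((p : EuclideanSpace ℝ (Fin 3)) - q) (G p - G q) = f p :=
    tendsto_nhds_unique hT hT'
  have hgb : ∀ q : Sites₀ t A, ‖forceConst ((p : EuclideanSpace ℝ (Fin 3)) - q) (G p - G q)‖ ≤ bound q :=
    fun q => le_of_tendsto (tendsto_norm.comp (hlim q)) (Eventually.of_forall fun V => hdom V q)
  have hs : Summable (fun q : Sites₀ t A => forceConst ((p : EuclideanSpace ℝ (Fin 3)) - q) (G p - G q)) :=
    hbs.of_norm_bounded hgb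
  rw [← heq]
  exact hs.hasSum

/-! ## Clause (iv): translation differences along the generators -/

/-- The three generators `u₁, u₂, w₃` are lattice vectors, and at the finite level the squared translation
differences along each are summable with `Σ'_p ‖u(p + Ae) − u p‖² ≤ 4 · nnForm u`. [folklore] -/
theorem translate_sq_le_finite (hA : Adm₀ A) (hI : Inner₀ t A) {e : EuclideanSpace ℝ (Fin 3)}
    (he : e ∈ ({triangularVec₁ 1, triangularVec₂ 1, layerNormal (2 * Real.sqrt (2 / 3))} :
      Finset (EuclideanSpace ℝ (Fin 3)))) :
    e ∈ Λ₀ ∧ ∀ u : EuclideanSpace ℝ (Fin 3) → EuclideanSpace ℝ (Fin 3), (Function.support u).Finite →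
      Summable (fun p : Sites₀ t A => ‖u (p + A e) - u p‖ ^ 2) ∧
      ∑' p : Sites₀ t A, ‖u (p + A e) - u p‖ ^ 2 ≤ 4 * nnForm t A u := by
  have key : ∀ τ : EuclideanSpace ℝ (Fin 3), τ ∈ Λ₀ →
      (∀ u : EuclideanSpace ℝ (Fin 3) → EuclideanSpace ℝ (Fin 3), (Function.support u).Finite →
        ∑' p : Sites₀ t A, ‖u p - u ((p : EuclideanSpace ℝ (Fin 3)) + A τ)‖ ^ 2 ≤ 4 * nnForm t A u) →
      ∀ u : EuclideanSpace ℝ (Fin 3) → EuclideanSpace ℝ (Fin 3), (Function.support u).Finite →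
        Summable (fun p : Sites₀ t A => ‖u (p + A τ) - u p‖ ^ 2) ∧
        ∑' p : Sites₀ t A, ‖u (p + A τ) - u p‖ ^ 2 ≤ 4 * nnForm t A u := by
    intro τ hτ hb u hu
    have hs := summable_norm_sub_map_sq (t := t) (A := A) hu (sitesTranslate_injective (t := t) (A := A) hτ)
    refine ⟨hs.congr fun p => by rw [norm_sub_rev], ?_⟩
    have hre : ∑' p : Sites₀ t A, ‖u (p + A τ) - u p‖ ^ 2 =
        ∑' p : Sites₀ t A, ‖u p - u ((p : EuclideanSpace ℝ (Fin 3)) + A τ)‖ ^ 2 :=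
      tsum_congr fun p => by rw [norm_sub_rev]
    rw [hre]
    exact hb u hu
  simp only [Finset.mem_insert, Finset.mem_singleton] at he
  rcases he with rfl | rfl | rfl
  · refine ⟨triangularVec₁_mem_Λ₀, key _ triangularVec₁_mem_Λ₀ fun u hu => ?_⟩
    have h := tsum_norm_sub_translate_sq_le_nnForm hA hI hu triangularVec₁_mem_Λ₀ (norm_apply_triangularVec_le hA).1
    linarith [nnForm_nonneg t A u]
  · refine ⟨triangularVec₂_mem_Λ₀, key _ triangularVec₂_mem_Λ₀ fun u hu => ?_⟩
    have h := tsum_norm_sub_translate_sq_le_nnForm hA hI hu triangularVec₂_mem_Λ₀ (norm_apply_triangularVec_le hA).2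
    linarith [nnForm_nonneg t A u]
  · exact ⟨layerNormal_two_mem_Λ₀, key _ layerNormal_two_mem_Λ₀ fun u hu =>
      tsum_norm_sub_vertical_sq_le_nnForm hA hI hu⟩

/-- **Translation differences of the limit** (clause (iv)): along `e ∈ {u₁, u₂, w₃}` the squared differences
`‖G(p + Ae) − G p‖²` are summable over the sites with sum `≤ 4 (N/κ)²`. [folklore] -/
theorem translate_sq_lim (hA : Adm₀ A) (hI : Inner₀ t A) (hκ : 0 < κ) (hPS : Blowdown.PSIneq κ t A) (hN : 0 ≤ N)
    (hf : ∀ w : EuclideanSpace ℝ (Fin 3) → EuclideanSpace ℝ (Fin 3), (Function.support w).Finite →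
      Function.support w ⊆ Sites₀ t A → |∑' p : Sites₀ t A, ⟪f p, w p⟫| ≤ N * Real.sqrt (nnForm t A w))
    (hU : ∀ V : Finset (Sites₀ t A), Function.support (U V) ⊆ Subtype.val '' (V : Set (Sites₀ t A)) ∧
      ∀ p : Sites₀ t A, p ∈ V →
        ∑' q : Sites₀ t A, forceConst ((p : EuclideanSpace ℝ (Fin 3)) - q) (U V p - U V q) = f p)
    {G : EuclideanSpace ℝ (Fin 3) → EuclideanSpace ℝ (Fin 3)}
    (hG : ∀ p : Sites₀ t A, Tendsto (fun V : Finset (Sites₀ t A) => U V p) atTop (𝓝 (G p)))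
    {e : EuclideanSpace ℝ (Fin 3)}
    (he : e ∈ ({triangularVec₁ 1, triangularVec₂ 1, layerNormal (2 * Real.sqrt (2 / 3))} :
      Finset (EuclideanSpace ℝ (Fin 3)))) :
    Summable (fun p : Sites₀ t A => ‖G (p + A e) - G p‖ ^ 2) ∧
      ∑' p : Sites₀ t A, ‖G (p + A e) - G p‖ ^ 2 ≤ 4 * (N / κ) ^ 2 := by
  obtain ⟨heΛ, hfam⟩ := translate_sq_le_finite (t := t) (A := A) hA hI he
  have hpt : ∀ p : Sites₀ t A, Tendsto (fun V : Finset (Sites₀ t A) => ‖U V (p + A e) - U V p‖ ^ 2) atTop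
      (𝓝 (‖G (p + A e) - G p‖ ^ 2)) := fun p =>
    (((hG ⟨(p : EuclideanSpace ℝ (Fin 3)) + A e, add_mem_sites₀ p.2 heΛ⟩).sub (hG p)).norm).pow 2
  have hT : ∀ T : Finset (Sites₀ t A), ∑ p ∈ T, ‖G (p + A e) - G p‖ ^ 2 ≤ 4 * (N / κ) ^ 2 := by
    intro T
    refine le_of_tendsto (tendsto_finsetSum T fun p _ => hpt p) (Eventually.of_forall fun V => ?_)
    obtain ⟨hs, hb⟩ := hfam (U V) (finite_support_of_subset_image (hU V).1)
    have hE := (energy_bounds hA hI hκ hPS hN hf (hU V).1 (hU V).2).2.1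
    calc ∑ p ∈ T, ‖U V (p + A e) - U V p‖ ^ 2 ≤ ∑' p : Sites₀ t A, ‖U V (p + A e) - U V p‖ ^ 2 :=
          hs.sum_le_tsum T fun p _ => sq_nonneg _
      _ ≤ 4 * nnForm t A (U V) := hb
      _ ≤ 4 * (N / κ) ^ 2 := by linarith
  have hs : Summable (fun p : Sites₀ t A => ‖G (p + A e) - G p‖ ^ 2) := summable_of_sum_le (fun p => sq_nonneg _) hT
  exact ⟨hs, hs.tsum_le_of_sum_le hT⟩

end

/-- Registered helper of sub-goal `blowdown_greenSolve` (H2 of stub `stub_green`, crux stmt-AtomisticToContinuum-9332,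
line `Sketch` v4): the rows of the force-constant operator pass to the pointwise limit of a Galerkin family.
[folklore] -/
theorem blowdown_galerkinRows : ∀ (κ : ℝ) (t : Fin 2 → (EuclideanSpace ℝ (Fin 3))) (A : (EuclideanSpace ℝ (Fin 3)) →L[ℝ] (EuclideanSpace ℝ (Fin 3))), 0 < κ → Adm₀ A → Inner₀ t A → Blowdown.PSIneq κ t A → ∀ (f : (EuclideanSpace ℝ (Fin 3)) → (EuclideanSpace ℝ (Fin 3))) (N : ℝ) (U : Finset (Sites₀ t A) → (EuclideanSpace ℝ (Fin 3)) → (EuclideanSpace ℝ (Fin 3))) (G : (EuclideanSpace ℝ (Fin 3)) → (EuclideanSpace ℝ (Fin 3))), 0 ≤ N → (∀ w : (EuclideanSpace ℝ (Fin 3)) → (EuclideanSpace ℝ (Fin 3)), (Function.support w).Finite → Function.support w ⊆ Sites₀ t A → |∑' p : Sites₀ t A, ⟪f p, w p⟫_ℝ| ≤ N * Real.sqrt (nnForm t A w)) → (∀ V : Finset (Sites₀ t A), Function.support (U V) ⊆ Subtype.val '' (V : Set (Sites₀ t A)) ∧ ∀ p : Sites₀ t A, p ∈ V → ∑' q : Sites₀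 t A, forceConst ((p : (EuclideanSpace ℝ (Fin 3))) - q) (U V p - U V q) = f p) → (∀ p : Sites₀ t A, Filter.Tendsto (fun V : Finset (Sites₀ t A) => U V p) Filter.atTop (nhds (G p))) → ∀ p : Sites₀ t A, HasSum (fun q : Sites₀ t A => forceConst ((p : (EuclideanSpace ℝ (Fin 3))) - q) (G p - G q)) (f p) :=
  fun _ _ _ hκ hA hI hPS _ _ _ _ hN hf hU hG p => hasSum_row_lim hA hI hκ hPS hN hf hU hG p

end Summit.AtomisticToContinuum.Crystallization.Theorems.ExcessDecayLiouville

end
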